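import Mathlib
import Summits.KontsevichZagierPeriods.Zeta5Search.TypeSpaceLawZeroPointProof
import Summits.KontsevichZagierPeriods.Zeta5Search.DenomLaw.LawA4Pal
import HarnessLib

/-!
# ζ(5) search — THEOREM ZA: the ZERO-POINT law and THEOREM A⁗′ in the same frame give one more digit, `v_p(Cas_j(b)) ≥ 8 − 2M` (DENOM-LAW D1, prover-d1 gen 20)

HONEST FRAMING: systematic search; no irrationality claim unless certified.  Cell `pub-zeta5`, track «DENOM-LAW» D1, seat `denom-prover-d1`
gen 20 (`HOME/denom-law/prover-d1/ATTEMPT-20.md` §4).  `p`-adic valuations of the cell's OWN rationals (the contiguity Casoratian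
`Cas_j(b) = W(b+e_j)V(b) − W(b)V(b+e_j)` of Brown–Zudilin dual coefficients); nothing about ζ(5); no model exponent (every γ of the cell is a
MODEL number `< 1`); records in print UNMOVED.

**THEOREM ZA.**  Window prime `5 ≤ p ≤ b₀ < p² − 2`, frame `M ≥ 6` even, palindromic `T`.  IF the hypotheses of the landed ZERO-POINT type-space
law (`ResidueLaw.TypeSpaceLawZeroPoint`, `typeSpaceLawZeroPoint_holds`, value `7 − 2M`: every pole class `E ≥ −M`, the classes of exponent `−M`
centre-free with palindromic type list, the degree condition `p(M−2) + ΣE_x ≤ −4`, all doubled orbit points of the live classes congruent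
mod `p`) hold AND the hypotheses of the landed THEOREM A⁗′ (`SecondOrder.lawA4Pal`, value `7 − 2M`: H1–H4 of `LawA4` with deep list `T` and
(T3′) «double raise or palindrome» at `ν = −M + 2`) hold IN THE SAME FRAME, then `v_p(Cas_j(b)) ≥ 8 − 2M` (= casLB + 5).
PROOF (three lines on top of the two landed aggregates): the zero-point mechanism (typer p3's `aggregate₃` + the residue congruence, copied
verbatim from `typeSpaceLawZeroPoint_of_residues`) gives `w := W/(−p)^{3−M} = O(p²)`, `v := V/(−p)^{−M} = O(p²)` for `b` and `b + e_j`;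
A⁗′'s aggregate (`aggregate₄P`, gen 10) gives `2(w, v) ≡ A·τ(T) (mod p³)`; hence `A·τ(T) = O(p²)` (`norm_At_le`) and the determinant
`w'v − wv'` is `O(p⁵)` (`det₅_amp₂`: the cross terms `O(p³)·O(p²)`), one order beyond either law.
WHY IT MATTERS (census of the ∀-`b` node `DenomLaw.PathAccountingFirstPeriod`, prover-d1 g20, exact valuations of g18's kit j267899): as the rung «ZA»
it has 0 port violations on the 352 applicable exact instances (p ≤ 7: 240; p = 11 sample: 112; margins 0/1/2 = 192/120/40) and ALONE closes
111 of the 499 instances left open by the landed laws at p ≤ 7 (22 %) and 70 of 364 in the p = 11 sample (19 %) — the «zero window + foreign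
classes at ν ≥ −M+3» configurations `(m, deep) = (−8, [−4,−4])`, `(−10, [1,−6,−6,1])`, … of ATTEMPT-18/19's open lists.  A BLIND LEG was sealed before
this file (HOME INBOX 2026-08-27T14:5xZ, `denom-law/prover-d1/g20/seal/SEAL-ZA.md`).
-/

noncomputable section

open Finset

namespace Summit.KontsevichZagierPeriods.Zeta5Search.SecondOrder

open Summit.KontsevichZagierPeriods.Zeta5Search.DualSeries (InBox)
open Summit.KontsevichZagierPeriods.Zeta5Search.WedgeDictionary (coeffW coeffV)
open Summit.KontsevichZagierPeriods.Zeta5Search.CasoratianValuation (InPolytope shift casoratian)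
open Summit.KontsevichZagierPeriods.Zeta5Search.ClusterValuation
open Summit.KontsevichZagierPeriods.Zeta5Search.PadicSeries
open Summit.KontsevichZagierPeriods.Zeta5Search.BigPrime (shift_zero)
open Summit.KontsevichZagierPeriods.Zeta5Search.ResidueLaw (pointW pointV liveClasses res0_padicNorm_le sum_classExp_range)
open Summit.KontsevichZagierPeriods.Zeta5Search.BigPrime (dOf_shift)

variable {p : ℕ} [hp : Fact p.Prime]

/-! ## §1 The determinant estimate one order further -/

/-- **`A·t` is `O(p²)` when `w` is**: `‖2w − At‖ ≤ p⁻³` and `‖w‖ ≤ p⁻²` give `‖At‖ ≤ p⁻²`. -/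
theorem norm_At_le (hp2 : p ≠ 2) {w At : ℚ} (h : padicNorm p (2 * w - At) ≤ (p : ℚ) ^ (-(3 : ℤ)))
    (hw : padicNorm p w ≤ (p : ℚ) ^ (-(2 : ℤ))) : padicNorm p At ≤ (p : ℚ) ^ (-(2 : ℤ)) := by
  have hp1 : (1 : ℚ) ≤ p := by exact_mod_cast hp.out.one_le
  have e : At = 2 * w - (2 * w - At) := by ring
  rw [e]
  refine (padicNorm.sub (p := p)).trans (max_le ?_ (h.trans (zpow_le_zpow_right₀ hp1 (by norm_num))))
  rw [padicNorm.mul, padicNorm_two hp2, one_mul]; exact hw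

/-- **Third-order collinearity with an `O(p²)` amplitude kills FIVE digits**: if `2w ≡ At_W`, `2v ≡ At_V`, `2w' ≡ A't_W`, `2v' ≡ A't_V (mod p³)`
with `‖At‖, ‖A't‖ ≤ p⁻²` (componentwise), then `‖w'v − wv'‖ ≤ p⁻⁵`. -/
theorem det₅_amp₂ (hp2 : p ≠ 2) {w v w' v' A A' tW tV : ℚ}
    (hw : padicNorm p (2 * w - A * tW) ≤ (p : ℚ) ^ (-(3 : ℤ))) (hv : padicNorm p (2 * v - A * tV) ≤ (p : ℚ) ^ (-(3 : ℤ)))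
    (hw' : padicNorm p (2 * w' - A' * tW) ≤ (p : ℚ) ^ (-(3 : ℤ))) (hv' : padicNorm p (2 * v' - A' * tV) ≤ (p : ℚ) ^ (-(3 : ℤ)))
    (hAW : padicNorm p (A * tW) ≤ (p : ℚ) ^ (-(2 : ℤ))) (hAV : padicNorm p (A * tV) ≤ (p : ℚ) ^ (-(2 : ℤ)))
    (hAW' : padicNorm p (A' * tW) ≤ (p : ℚ) ^ (-(2 : ℤ))) (hAV' : padicNorm p (A' * tV) ≤ (p : ℚ) ^ (-(2 : ℤ))) :
    padicNorm p (w' * v - w * v') ≤ (p : ℚ) ^ (-(5 : ℤ)) := by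
  have hpQ : (p : ℚ) ≠ 0 := Nat.cast_ne_zero.2 hp.out.ne_zero
  have hp1 : (1 : ℚ) ≤ p := by exact_mod_cast hp.out.one_le
  have h4 : padicNorm p ((1 : ℚ) / 4) = 1 := by
    rw [show ((1 : ℚ) / 4) = 1 / (2 * 2) by norm_num, padicNorm.div, padicNorm.one, padicNorm.mul, padicNorm_two hp2]; norm_num
  set r₁ := 2 * w - A * tW
  set r₂ := 2 * v - A * tV
  set r₃ := 2 * w' - A' * tW
  set r₄ := 2 * v' - A' * tV
  have hexp : w' * v - w * v' = (1 : ℚ) / 4 * ((r₃ * r₂ - r₁ * r₄) + (r₃ * (A * tV) + (A' * tW) * r₂ - r₁ * (A' * tV) - (A * tW) * r₄)) := by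
    simp only [r₁, r₂, r₃, r₄]; ring
  have hrr : ∀ {a c : ℚ}, padicNorm p a ≤ (p : ℚ) ^ (-(3 : ℤ)) → padicNorm p c ≤ (p : ℚ) ^ (-(3 : ℤ)) →
      padicNorm p (a * c) ≤ (p : ℚ) ^ (-(5 : ℤ)) := fun ha hc => by
    rw [padicNorm.mul]
    calc _ ≤ (p : ℚ) ^ (-(3 : ℤ)) * (p : ℚ) ^ (-(3 : ℤ)) := mul_le_mul ha hc (padicNorm.nonneg _) (zpow_p_nonneg _)
      _ = (p : ℚ) ^ (-(6 : ℤ)) := by rw [← zpow_add₀ hpQ]; norm_num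
      _ ≤ _ := zpow_le_zpow_right₀ hp1 (by norm_num)
  have hra : ∀ {a c : ℚ}, padicNorm p a ≤ (p : ℚ) ^ (-(3 : ℤ)) → padicNorm p c ≤ (p : ℚ) ^ (-(2 : ℤ)) →
      padicNorm p (a * c) ≤ (p : ℚ) ^ (-(5 : ℤ)) := fun ha hc => by
    rw [padicNorm.mul]
    calc _ ≤ (p : ℚ) ^ (-(3 : ℤ)) * (p : ℚ) ^ (-(2 : ℤ)) := mul_le_mul ha hc (padicNorm.nonneg _) (zpow_p_nonneg _)
      _ = (p : ℚ) ^ (-(5 : ℤ)) := by rw [← zpow_add₀ hpQ]; norm_num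
  have har : ∀ {a c : ℚ}, padicNorm p a ≤ (p : ℚ) ^ (-(2 : ℤ)) → padicNorm p c ≤ (p : ℚ) ^ (-(3 : ℤ)) →
      padicNorm p (a * c) ≤ (p : ℚ) ^ (-(5 : ℤ)) := fun ha hc => by rw [mul_comm]; exact hra hc ha
  rw [hexp, padicNorm.mul, h4, one_mul]
  refine (padicNorm.nonarchimedean (p := p)).trans (max_le ?_ ?_)
  · exact (padicNorm.sub (p := p)).trans (max_le (hrr hw' hv) (hrr hw hv'))
  · have k1 := hra hw' hAV
    have k2 := har hAW' hv
    have k3 := hra hw hAV'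
    have k4 := har hAW hv'
    have s2 := (padicNorm.nonarchimedean (p := p)).trans (max_le k1 k2)
    have s3 := (padicNorm.sub (p := p)).trans (max_le s2 k3)
    exact (padicNorm.sub (p := p)).trans (max_le s3 k4)

/-! ## §2 THEOREM ZA -/

/-- **THEOREM ZA — conditional form**: the class hypotheses of `TypeSpaceLawZeroPoint` with the residue congruences for `b` and `b + e_j` and all live
doubled orbit points congruent mod `p`, together with the hypotheses H1–H4, (T3′) of THEOREM A⁗′ in the same frame `(M, T)`, give
`v_p(Cas_j(b)) ≥ 8 − 2M`. -/
theorem zeroPointA4_of_residues (b : ℕ → ℤ) (p j M : ℕ) (T : List ℤ) (hb : InPolytope b) (hb' : InPolytope (shift b j))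
    (hj1 : 1 ≤ j) (hj7 : j ≤ 7) (hprime : p.Prime) (hp5 : 5 ≤ p) (hpb : (p : ℤ) ≤ b 0) (hwin : (b 0 + 2 : ℤ) < (p : ℤ) ^ 2)
    (hM : 6 ≤ M) (hMe : Even M)
    (G1 : ∀ x, x < p → 1 ≤ classPoleCount b p x → -(M : ℤ) ≤ classExp b p x)
    (G3 : ∀ x, x < p → 1 ≤ classPoleCount b p x → classExp b p x = -(M : ℤ) →
      ¬ CentreIn b p x ∧ (classTypeList b p x).reverse = classTypeList b p x)
    (HP : ∀ x ∈ liveClasses b p M, ∀ y ∈ liveClasses b p M,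
        (pointW b p M y - pointW b p M x = 0 ∨ 1 ≤ padicValRat p (pointW b p M y - pointW b p M x)) ∧
        (pointV b p M y - pointV b p M x = 0 ∨ 1 ≤ padicValRat p (pointV b p M y - pointV b p M x)))
    (hres : padicNorm p
      ((∑ z ∈ (range p).filter (fun x => 1 ≤ classPoleCount b p x ∧ classExp b p x = -(M : ℤ)), gHat b p z * phiHat b p z)
        + ∑ z ∈ (range p).filter (fun x => 1 ≤ classPoleCount b p x ∧ classExp b p x = -(M : ℤ) + 1), gHat b p z)
      ≤ (p : ℚ) ^ (-(1 : ℤ)))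
    (hres' : padicNorm p
      ((∑ z ∈ (range p).filter (fun x => 1 ≤ classPoleCount (shift b j) p x ∧ classExp (shift b j) p x = -(M : ℤ)),
          gHat (shift b j) p z * phiHat (shift b j) p z)
        + ∑ z ∈ (range p).filter (fun x => 1 ≤ classPoleCount (shift b j) p x ∧ classExp (shift b j) p x = -(M : ℤ) + 1),
          gHat (shift b j) p z)
      ≤ (p : ℚ) ^ (-(1 : ℤ)))
    (hT : T.reverse = T)
    (H1 : ∀ x ∈ multipoleClasses b p, -(M : ℤ) ≤ classExp b p x)
    (H2 : ∀ y, y < p → classPoleCount b p y = 1 → -(M : ℤ) + 1 ≤ classNu b p y)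
    (H3 : ∀ x ∈ multipoleClasses b p, classExp b p x = -(M : ℤ) → ¬ CentreIn b p x ∧ classTypeList b p x = T)
    (H4 : ∀ y, y < p → 1 ≤ classPoleCount b p y → classNu b p y = -(M : ℤ) + 1 →
        isRaise T (classTypeList b p y) = true ∨ (¬ (2 : ℤ) ∣ b 0 ∧ CentreIn b p y ∧ classTypeList b p y = T))
    (H5P : ∀ z, z < p → 1 ≤ classPoleCount b p z → classNu b p z = -(M : ℤ) + 2 →
        isRaise2 T (classTypeList b p z) = true ∨ (classTypeList b p z).reverse = classTypeList b p z)
    (hcas : casoratian b j ≠ 0) : (8 : ℤ) - 2 * M ≤ padicValRat p (casoratian b j) := by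
  haveI : Fact p.Prime := ⟨hprime⟩
  have hp0 : (p : ℚ) ≠ 0 := Nat.cast_ne_zero.2 hprime.ne_zero
  have hpneg : (-(p : ℚ)) ≠ 0 := neg_ne_zero.2 hp0
  have hp2 : p ≠ 2 := by omega
  have h0 : 0 ≤ b 0 := hb.1.1
  obtain ⟨-, -, -, hn⟩ := thmA_data b hb hwin
  have h4n : padicNorm p (4 : ℚ) = 1 := by
    rw [show (4 : ℚ) = 2 * 2 by norm_num, padicNorm.mul, padicNorm_two hp2, one_mul]
  -- the aggregates for `b` and `b + e_j`
  obtain ⟨X, Y, k, hX1, hY1, hW, hV, hk1, hkL, hksum, hXa, hYa⟩ := aggregate₃ b hb hp5 hpb hwin hM hMe G1 G3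
  have hpb' : (p : ℤ) ≤ shift b j 0 := by rw [shift_zero b hj1]; exact hpb
  have hwin' : (shift b j 0 + 2 : ℤ) < (p : ℤ) ^ 2 := by rw [shift_zero b hj1]; exact hwin
  obtain ⟨X', Y', k', hX1', hY1', hW', hV', hk1', hkL', hksum', hXa', hYa'⟩ := aggregate₃ (shift b j) hb' hp5 hpb' hwin' hM hMe
    (G1_shift b hb hj1 G1) (G3_shift b hb hb' hj1 hj7 hpb G1 G3)
  have hPt : ∀ z, k' z ≠ 0 → z ∈ liveClasses b p M ∧ pointW (shift b j) p M z = pointW b p M z ∧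
      pointV (shift b j) p M z = pointV b p M z := fun z hz =>
    point_transfer b hb hb' hj1 hj7 hpb hM hMe G1 G3 (hkL' z hz)
  -- a base point
  obtain ⟨x₀, hx₀⟩ : ∃ x₀, ∀ z ∈ liveClasses b p M, x₀ ∈ liveClasses b p M := by
    by_cases h : (liveClasses b p M).Nonempty
    · obtain ⟨x, hx⟩ := h; exact ⟨x, fun _ _ => hx⟩
    · exact ⟨0, fun z hz => absurd ⟨z, hz⟩ h⟩
  have hP0 := padicNorm_point_le_one b h0 hn hp2 M x₀
  -- the weight sums are `O(p)`
  have hsum : padicNorm p (∑ z ∈ range p, k z) ≤ (p : ℚ) ^ (-(1 : ℤ)) := by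
    have e : ∑ z ∈ range p, k z = (4 * ∑ z ∈ range p, k z) / 4 := by ring
    rw [e, padicNorm.div, h4n, div_one, hksum]; exact hres
  have hsum' : padicNorm p (∑ z ∈ range p, k' z) ≤ (p : ℚ) ^ (-(1 : ℤ)) := by
    have e : ∑ z ∈ range p, k' z = (4 * ∑ z ∈ range p, k' z) / 4 := by ring
    rw [e, padicNorm.div, h4n, div_one, hksum']; exact hres'
  -- all points equal mod `p` ⇒ the aggregates vanish mod `p`
  have hXp : padicNorm p X ≤ (p : ℚ) ^ (-(1 : ℤ)) :=
    norm_le_of_equal_points hXa hsum hk1 hP0.1 fun z hz =>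
      padicNorm_le_of_zero_or_val (HP x₀ (hx₀ z (hkL z hz)) z (hkL z hz)).1
  have hYp : padicNorm p Y ≤ (p : ℚ) ^ (-(1 : ℤ)) :=
    norm_le_of_equal_points hYa hsum hk1 hP0.2 fun z hz =>
      padicNorm_le_of_zero_or_val (HP x₀ (hx₀ z (hkL z hz)) z (hkL z hz)).2
  have hXp' : padicNorm p X' ≤ (p : ℚ) ^ (-(1 : ℤ)) :=
    norm_le_of_equal_points hXa' hsum' hk1' hP0.1 fun z hz => by
      obtain ⟨hzL, hPW, -⟩ := hPt z hz
      rw [hPW]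
      exact padicNorm_le_of_zero_or_val (HP x₀ (hx₀ z hzL) z hzL).1
  have hYp' : padicNorm p Y' ≤ (p : ℚ) ^ (-(1 : ℤ)) :=
    norm_le_of_equal_points hYa' hsum' hk1' hP0.2 fun z hz => by
      obtain ⟨hzL, -, hPV⟩ := hPt z hz
      rw [hPV]
      exact padicNorm_le_of_zero_or_val (HP x₀ (hx₀ z hzL) z hzL).2
  -- ### the normalised forms are `O(p²)`
  set w := coeffW b / (-(p : ℚ)) ^ (-(M : ℤ) + 3)
  set v := coeffV b / (-(p : ℚ)) ^ (-(M : ℤ))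
  set w' := coeffW (shift b j) / (-(p : ℚ)) ^ (-(M : ℤ) + 3)
  set v' := coeffV (shift b j) / (-(p : ℚ)) ^ (-(M : ℤ))
  have hw := norm_le_two_of_X hW hXp
  have hv := norm_le_two_of_X hV hYp
  have hw' := norm_le_two_of_X hW' hXp'
  have hv' := norm_le_two_of_X hV' hYp'
  -- ### A⁗′'s aggregates: `2(w, v) ≡ A·τ(T) (mod p³)` for `b` and `b + e_j`
  obtain ⟨A, hW2, hV2, -, -⟩ := aggregate₄P b hb hp5 hpb hwin M hM hMe T hT H1 H2 H3 H4 H5P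
  have H4' := H4_shift b hb hb' hj1 hj7 hpb hM H1 H2 H3 H4
  have H5P' := H5P_shift b hb hb' hj1 hj7 hpb hM H1 H2 H3 H4 H5P
  obtain ⟨A', hW2', hV2', -, -⟩ := aggregate₄P (shift b j) hb' hp5 hpb' hwin' M hM hMe T hT
    (H1_shift b hb hj1 H1) (H2_shift b hb hb' hj1 hj7 hM H1 H2) (H3_shift b hb hb' hj1 hj7 hpb H1 H3) H4' H5P'
  -- ### hence `A·τ = O(p²)` and the determinant is `O(p⁵)`
  have hdet : padicNorm p (w' * v - w * v') ≤ (p : ℚ) ^ (-(5 : ℤ)) :=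
    det₅_amp₂ hp2 hW2 hV2 hW2' hV2' (norm_At_le hp2 hW2 hw) (norm_At_le hp2 hV2 hv) (norm_At_le hp2 hW2' hw') (norm_At_le hp2 hV2' hv')
  have hcasE : casoratian b j = (-(p : ℚ)) ^ (-(M : ℤ) + 3) * (-(p : ℚ)) ^ (-(M : ℤ)) * (w' * v - w * v') := by
    have e1 : coeffW b = w * (-(p : ℚ)) ^ (-(M : ℤ) + 3) := by
      simp only [w]; rw [div_mul_cancel₀ _ (zpow_ne_zero _ hpneg)]
    have e2 : coeffV b = v * (-(p : ℚ)) ^ (-(M : ℤ)) := by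
      simp only [v]; rw [div_mul_cancel₀ _ (zpow_ne_zero _ hpneg)]
    have e3 : coeffW (shift b j) = w' * (-(p : ℚ)) ^ (-(M : ℤ) + 3) := by
      simp only [w']; rw [div_mul_cancel₀ _ (zpow_ne_zero _ hpneg)]
    have e4 : coeffV (shift b j) = v' * (-(p : ℚ)) ^ (-(M : ℤ)) := by
      simp only [v']; rw [div_mul_cancel₀ _ (zpow_ne_zero _ hpneg)]
    unfold casoratian
    rw [e1, e2, e3, e4]; ring
  apply val_ge_of_padicNorm_le hcas
  rw [hcasE, padicNorm.mul, padicNorm.mul, LevelClass.padicNorm_neg_p_zpow, LevelClass.padicNorm_neg_p_zpow]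
  calc (p : ℚ) ^ (-(-(M : ℤ) + 3)) * (p : ℚ) ^ (-(-(M : ℤ))) * padicNorm p (w' * v - w * v')
      ≤ (p : ℚ) ^ (-(-(M : ℤ) + 3)) * (p : ℚ) ^ (-(-(M : ℤ))) * (p : ℚ) ^ (-(5 : ℤ)) :=
        mul_le_mul_of_nonneg_left hdet (mul_nonneg (zpow_p_nonneg _) (zpow_p_nonneg _))
    _ = (p : ℚ) ^ (-((8 : ℤ) - 2 * M)) := by
        rw [← zpow_add₀ hp0, ← zpow_add₀ hp0]; congr 1; ring

/-- **THEOREM ZA**: `ResidueLaw.TypeSpaceLawZeroPoint`'s hypotheses (degree condition `p(M−2) + ΣE_x ≤ −4`, all live points congruent) AND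
THEOREM A⁗′'s hypotheses in the same frame `(M, T)` give `v_p(Cas_j(b)) ≥ 8 − 2M`. -/
theorem lawZeroPointA4 (b : ℕ → ℤ) (p j M : ℕ) (T : List ℤ) (hb : InPolytope b) (hb' : InPolytope (shift b j))
    (hj1 : 1 ≤ j) (hj7 : j ≤ 7) (hprime : p.Prime) (hp5 : 5 ≤ p) (hpb : (p : ℤ) ≤ b 0) (hwin : (b 0 + 2 : ℤ) < (p : ℤ) ^ 2)
    (hM : 6 ≤ M) (hMe : Even M)
    (G1 : ∀ x, x < p → 1 ≤ classPoleCount b p x → -(M : ℤ) ≤ classExp b p x)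
    (G3 : ∀ x, x < p → 1 ≤ classPoleCount b p x → classExp b p x = -(M : ℤ) →
      ¬ CentreIn b p x ∧ (classTypeList b p x).reverse = classTypeList b p x)
    (hdeg : (p : ℤ) * ((M : ℤ) - 2) + ∑ x ∈ range p, classExp b p x ≤ -4)
    (HP : ∀ x ∈ liveClasses b p M, ∀ y ∈ liveClasses b p M,
        (pointW b p M y - pointW b p M x = 0 ∨ 1 ≤ padicValRat p (pointW b p M y - pointW b p M x)) ∧
        (pointV b p M y - pointV b p M x = 0 ∨ 1 ≤ padicValRat p (pointV b p M y - pointV b p M x)))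
    (hT : T.reverse = T)
    (H1 : ∀ x ∈ multipoleClasses b p, -(M : ℤ) ≤ classExp b p x)
    (H2 : ∀ y, y < p → classPoleCount b p y = 1 → -(M : ℤ) + 1 ≤ classNu b p y)
    (H3 : ∀ x ∈ multipoleClasses b p, classExp b p x = -(M : ℤ) → ¬ CentreIn b p x ∧ classTypeList b p x = T)
    (H4 : ∀ y, y < p → 1 ≤ classPoleCount b p y → classNu b p y = -(M : ℤ) + 1 →
        isRaise T (classTypeList b p y) = true ∨ (¬ (2 : ℤ) ∣ b 0 ∧ CentreIn b p y ∧ classTypeList b p y = T))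
    (H5P : ∀ z, z < p → 1 ≤ classPoleCount b p z → classNu b p z = -(M : ℤ) + 2 →
        isRaise2 T (classTypeList b p z) = true ∨ (classTypeList b p z).reverse = classTypeList b p z)
    (hcas : casoratian b j ≠ 0) : (8 : ℤ) - 2 * M ≤ padicValRat p (casoratian b j) := by
  haveI : Fact p.Prime := ⟨hprime⟩
  have hdegb : (p : ℤ) * ((M : ℤ) - 2) + ∑ x ∈ range p, classExp b p x ≤ -2 := by omega
  have hsum : ∑ x ∈ range p, classExp (shift b j) p x = ∑ x ∈ range p, classExp b p x + 2 := by
    rw [sum_classExp_range (shift b j) hb' hp5, sum_classExp_range b hb hp5, dOf_shift b hj1 hj7]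
    ring
  have hdeg' : (p : ℤ) * ((M : ℤ) - 2) + ∑ x ∈ range p, classExp (shift b j) p x ≤ -2 := by omega
  have hpb' : (p : ℤ) ≤ shift b j 0 := by rw [shift_zero b hj1]; exact hpb
  exact zeroPointA4_of_residues b p j M T hb hb' hj1 hj7 hprime hp5 hpb hwin hM hMe G1 G3 HP
    (res0_padicNorm_le b M hb hp5 hpb (by omega) G1 hdegb)
    (res0_padicNorm_le (shift b j) M hb' hp5 hpb' (by omega) (G1_shift b hb hj1 G1) hdeg') hT H1 H2 H3 H4 H5P hcas

end Summit.KontsevichZagierPeriods.Zeta5Search.SecondOrder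

end
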